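import Summits.BirchSwinnertonDyer.Rank1Residual.ManinAdditive.ShimuraIndexSignLaws
import Summits.BirchSwinnertonDyer.Rank1Residual.ManinAdditive.ShimuraIndexAtkinLehnerProofs
import Summits.BirchSwinnertonDyer.Rank1Residual.ManinAdditive.ShimuraCuspLifting
import Summits.BirchSwinnertonDyer.Rank1Residual.ManinAdditive.PlusIndexLaws
import HarnessLib
import HarnessLib.Audit.Tags

/-!
# HESSE OPTIMALITY AT 3 — where the `X₀(N)`-optimal curve sits in a `ℤ/3 ⊕ μ₃` isogeny class, by `v₃(N)`
# (cell `bsd-f2-manin`, planner an g40; laws E-an-223 / E-an-223♯, the `μ`-type node E-an-225, E-an-222ₒ; PROVED edges)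

SEARCH QUESTION of the cell («which local invariant at 3 controls …»), optimal-curve bookkeeping side.  A **Hesse class** is an
isogeny class over `ℚ` containing a curve `E_H` with `E_H[3] ≅ ℤ/3ℤ ⊕ μ₃` (mod-3 image `3Cs.1.1`); its `3`-neighbours are
`E_H/μ₃` (rational `3`-torsion, no `μ₃`) and `E_H/(ℤ/3)` (`μ₃`, no rational `3`-torsion).  CERTIFIED CENSUS (an g40,
`hesse224.py` e53e12ce0be85671 / `hesse224-out.txt` 66b5fb18266402f0; Cremona's `opt_man` optimality codes, every class `N ≤ 400 000`
determined; Sutherland `galrep` labels): the `X₀(N)`-optimal curve of a Hesse class is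

| `v₃(N)` | classes | `E_H` | `E_H/μ₃` | `E_H/(ℤ/3)` |
|---|---|---|---|---|
| `0` | 733 | 35 | 698 | **0** |
| `1` | 397 | **0** | **397** | **0** |
| `2` | 455 | **0** | **0** | **455** |
| `≥ 3` | 445 | 224 | 221 | **0** |

and in the 4 030 classes with a TWISTED split mod-3 image (`3Cs`, `ψ ⊕ ψ⁻¹χ₃`, `ψ ≠ 1`) the split member is optimal in
`0 / 1852`, `0 / 579`, `0 / 657`, `499 / 942` classes (`v₃(N) = 0, 1, 2, ≥ 3`).  LAWS typed here (nothing asserted):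
* **E-an-223** `HesseNotOptimalAtTameThree` — a lattice-optimal `W` with `3 ∣ N`, `27 ∤ N` is never Hesse: `μ₃ ⊂ W` excludes a
  rational point of order `3` (0 / 852 classes);
* **E-an-223♯** `SplitThreeNotOptimalAtTameThree` — same hypotheses: `W[3]` has at most ONE `Γ_ℚ`-stable line (0 / 2 088);
* **E-an-225** `ShimuraThreeKernelHasMuThree` — the `μ`-TYPE NODE (printed-derivable: `[Λ₀:Λ₁] = #(E₀ ∩ Σ(N))`, `Σ(N)` of
  multiplicative type — Ling–Oesterlé 1991, Vatsal 2005 Rem. 1.8 — and the tree's `μ₃`-configuration dictionary): a Shimura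
  `3`-kernel puts `μ₃` inside the optimal curve; it implies es's E-es-67♮ (`plusIndexPrimeToThreeOfNoMuThree_of_muType`, PROVED);
* **E-an-226 / E-an-226♮** `MuThreeSignAtThree` / `ThreeTorsionSignAtThree` — LOCAL sign lemmas at multiplicative `3`
  (`μ₃ ⊂ W` or a rational `3`-torsion point, `3 ∥ N` ⟹ split multiplicative ⟹ `λ₃(f) = −1`; paper-provable, 30 835 / 30 835);
* **E-an-222ₒ** `ShimuraThreeKernelForcesTwentySevenOpt` — optimal form of an g40's level law E-an-222, now covering `3 ∥ N` too:
  a Shimura `3`-kernel with `3 ∣ N` forces `27 ∣ N`; restriction nodes `ShimuraIndexPrimeToThreeAtMultiplicativeThree` (`3 ∥ N`,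
  no optimality) and `ShimuraThreeForcesRationalThreeTorsionAtTameNine` (E-an-128 = E-an-221's parent at `9 ∥ N`).
PROVED EDGES (es's THEOREM AL₍₃₎ `shimuraIndexPrimeTo_of_atkinLehnerEigenvalueAt_eq_neg_one` does the work):
`shimuraIndexPrimeToThreeAtMultiplicativeThree_of_signLemmas` (`3 ∥ N` ⟸ E-an-226 ∧ E-an-226♮ — no law, no optimality),
`shimuraThreeForcesRationalThreeTorsionAtTameNine_of_signLaw` (E-an-128|`9 ∥ N` ⟸ E-es-72 ALONE),
`shimuraThreeKernelForcesTwentySevenOpt_of_laws` (E-an-222ₒ ⟸ E-an-223 ∧ E-an-225 ∧ E-an-226 ∧ E-es-72) and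
`shimuraThreeKernelForcesTwentySevenOpt_of_hesse` (E-an-222ₒ ⟸ E-an-223 ∧ E-an-128 ∧ E-an-225; with an g40's
`CuspLiftingOfCuspAnnihilator` E-an-128 ⟸ F★₀ ∧ E-es-80).
MECHANISM (heuristic, MEMO-an §85.3): Stevens (the `X₁`-optimal curve `E₁` has minimal Faltings height) + the local fact that the
height-LOWERING `3`-isogeny out of `E_H` is the quotient by the line that is connected in the Néron model at `3` — the `μ₃`-line
when `3` is good-ordinary / multiplicative / wild, but the `ℤ/3`-line when `3` is TAME ADDITIVE (`9 ∥ N`: `E_H` is the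
`ℚ₃(√−3)`-twist of a semistable curve and `χ₃·χ₃ = 1` swaps the lines) — and `E₀ = E₁/K` with `K` CONSTANT (Cartier dual of
`E₀ ∩ Σ(N)`): at `9 ∥ N`, `E₁ = E_H/(ℤ/3)` has no rational `3`-torsion, so `K = 0` and `E₀ = E₁` (row `2`); the vanishing of
the `E_H` column at `3 ∥ N` is the Stein–Watkins phenomenon (no `(A)`-curve `y² + axy + y = x³` is multiplicative at `3`).
bears_on: stmt-BirchSwinnertonDyer-22968 (C3 `ManinPrimeToThreeAtNine`).  PARTITION 0.  BSD is not proved by this; Manin's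
conjecture is not proved by this.

TYPER NOTE (typer g21, T-an-52).  SOURCE = HOME/an/g40/HesseOptimalityAtThree-an-g40.lean (FILE M) sha16 f673d250df5cb1b9 (234 l.; an:
farm rc 0 · 0 err · 0 warn · 0 sorry, audit 8 `@[conjecture]` + 6 proof-of-item; BC7 Probe-bc7-M-g40.lean; MEMO-an §85, HOME/an/MEMO-an-85.md
4ba9f406488a7082; census scripts hesse223/223b/224/sign226-an-g40.py + outputs in HOME/an/g40/, SHA16-g40.txt).  SPLIT BY IMPORT CONE
(typer/README gotcha 20/96): FILE M imports `…Theorems.ManinLocalTwoThreeShimuraIndexMuThree`, which is INSIDE the `Theses.ManinLocalTwoThree`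
cone (← ThreeBlindInvariance ← CubeLawCubeCriterion ← ManinOddOfReducibleOfCuspidalKummer ← KatoShiftTwoLaws ← KatoShiftThreeLawsEdges ←
Theses.ManinLocalTwoThree; 423 Summits modules), and only the two edges that call
`exists_isShortThreeTorsion_or_hasShortMuThree_of_not_shimuraIndexPrimeTo_three` need it.  THIS FILE = the ROUTE-INDEPENDENT LEAF: an's
module docstring, ALL EIGHT `@[conjecture]` decls of §1 (an's own tags, bodies VERBATIM) and the four cone-free PROVED edges of §2
(`shimuraThreeForcesRationalThreeTorsionAtTameNine_of_cuspLifting`, `shimuraThreeKernelForcesTwentySevenOpt_of_laws`, `…Opt_of_hesse`,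
`plusIndexPrimeToThreeOfNoMuThree_of_muType`); imports = an's four landed `…ManinAdditive.ShimuraIndexSignLaws` / `…ShimuraIndexAtkinLehnerProofs`
/ `…ShimuraCuspLifting` / `…PlusIndexLaws` (all Theses-free) + HarnessLib(+Audit.Tags).  The sibling CONE LEAF `HesseOptimalityAtThreeSplit.lean`
(imports this file + the Theorems module) carries VERBATIM `shimuraIndexPrimeToThreeAtMultiplicativeThree_of_signLemmas` (3 ∥ N ⟸ E-an-226 ∧
E-an-226♮) and `shimuraThreeForcesRationalThreeTorsionAtTameNine_of_signLaw` (E-an-128|9 ∥ N ⟸ E-es-72 alone).  Typer deltas: the Theorems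
import and the `open …Theorems.ManinLocalTwoThree` line moved to the sibling; «PROVED below» → «PROVED in the sibling …» in the docstrings of
`ShimuraIndexPrimeToThreeAtMultiplicativeThree` / `ShimuraThreeForcesRationalThreeTorsionAtTameNine`; nothing else.  ROWS: **E-an-223
`HesseNotOptimalAtTameThree`**, **E-an-223♯ `SplitThreeNotOptimalAtTameThree`** (cell LAWS; certified census hesse224: 0 optimal Hesse / split
members at v₃(N) ∈ {1,2}, N ≤ 4·10⁵ — 0/852 and 0/2 088 classes), **E-an-225 `ShimuraThreeKernelHasMuThree`** (μ-type node, printed-derivable: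
Ling–Oesterlé 1991 + Vatsal 2005 Rem. 1.8 + Stevens 1989), **E-an-226 `MuThreeSignAtThree`** / **E-an-226♮ `ThreeTorsionSignAtThree`** (local
sign lemmas at 3 ∥ N, paper-provable, Atkin–Lehner 1970 Thm 3; 30 835/30 835), restriction nodes `ShimuraIndexPrimeToThreeAtMultiplicativeThree`,
`ShimuraThreeForcesRationalThreeTorsionAtTameNine`, **E-an-222ₒ `ShimuraThreeKernelForcesTwentySevenOpt`** (optimal form of E-an-222,
`ShimuraThreeKernelLevel.lean`, T-an-51).  REFUTER: ref1 / ref2 R-an-79 PENDING at landing; data D-an-26 asked.  Typer checks: 8 def + 6 theorem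
names fresh tree-wide; cite keys LingOesterle1991 / Vatsal2005 / Stevens1989 / AtkinLehner1970 / ByeonYhee2013 in references.bib; no
instances, no notation, no sorry; < 400 lines.  PARTITION 0 · beyond-print theorem: no · bears_on: stmt-BirchSwinnertonDyer-22968 (C3
`ManinPrimeToThreeAtNine`).  BSD is not proved by this; Manin `c = 1` is not proved by this; C3 OPEN.
-/

noncomputable section

open scoped Classical MatrixGroups ModularForm ComplexConjugate

open CongruenceSubgroup Complex WeierstrassCurve UpperHalfPlane Field Literature.NumberTheory.EllipticCurves
  Literature.NumberTheory.EllipticCurves.ModularForms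

namespace Summit.BirchSwinnertonDyer.Rank1Residual.ManinAdditive.HesseOptimality

open Summit.BirchSwinnertonDyer.Rank1Residual.ManinAdditive.KatoCurve
  Summit.BirchSwinnertonDyer.Rank1Residual.ManinAdditive.CuspidalKummer
  Summit.BirchSwinnertonDyer.Rank1Residual.ManinAdditive.CuspidalKummerThree

/-! ### §1. The laws (typed `Prop`s; `@[conjecture]` = cell candidate, NOT a tree fact) -/

/-- **E-an-223 (HESSE NON-OPTIMALITY AT TAME OR MULTIPLICATIVE 3).**  A lattice-optimal (`Λ_W = c·Λ₀(f)`), globally minimal `W`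
with `3 ∣ N` and `27 ∤ N` that contains `μ₃` (`HasShortMuThree W c`) has NO rational point of order `3` on `E_{W,c}` — i.e. the
`X₀(N)`-optimal curve is never the Hesse member `E_H` (`E_H[3] ≅ ℤ/3 ⊕ μ₃`) of its class unless `3 ∤ N` or `27 ∣ N`.
BC5 (certified census, an g40 `hesse224-out.txt` 66b5fb18266402f0): 0 optimal Hesse curves in the 397 + 455 Hesse classes with
`v₃(N) ∈ {1, 2}`, `N ≤ 400 000` (vs 35 / 733 at `v₃(N) = 0` and 224 / 445 at `v₃(N) ≥ 3`).  Cheapest falsifier: one optimal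
curve with galrep `3Cs.1.1` and `v₃(N) ∈ {1,2}` (a table lookup; run: 0).  [conjecture — cell candidate, NOT a tree fact] -/
@[conjecture]
def HesseNotOptimalAtTameThree : Prop :=
  ∀ (W : WeierstrassCurve ℚ) [W.IsElliptic] [W.IsGloballyMinimal] {N : ℕ} [NeZero N]
    (D : ModularParametrizationData W N),
    (∀ z ∈ D.L.lattice, ∃ w ∈ periodLattice D.f, z = D.c * w) → 3 ∣ N → ¬ 3 ^ 3 ∣ N →
    HasShortMuThree W D.c → ∀ X₀ Y₀ : ℚ, ¬ IsShortThreeTorsion W D.c X₀ Y₀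

/-- **E-an-223♯ (SPLIT-CARTAN FORM).**  Same hypotheses (`3 ∣ N`, `27 ∤ N`, lattice-optimal): `W[3]` carries at most ONE
`Γ_ℚ`-stable line — the optimal curve never has split mod-`3` image (Hesse OR twisted `ψ ⊕ ψ⁻¹χ₃`).  BC5: 0 / 2 088 classes
(`852` Hesse + `1 236` twisted) with `v₃(N) ∈ {1,2}`, `N ≤ 400 000`; at `v₃(N) = 0` the twisted member is optimal in 0 / 1 852
classes as well (not claimed here), at `v₃(N) ≥ 3` in 499 / 942.  Implies E-an-223 on paper (a rational `3`-torsion point and a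
`μ₃`-point span two distinct stable lines).  [conjecture — cell candidate, NOT a tree fact] -/
@[conjecture]
def SplitThreeNotOptimalAtTameThree : Prop :=
  ∀ (W : WeierstrassCurve ℚ) [W.IsElliptic] [W.IsGloballyMinimal] {N : ℕ} [NeZero N]
    (D : ModularParametrizationData W N),
    (∀ z ∈ D.L.lattice, ∃ w ∈ periodLattice D.f, z = D.c * w) → 3 ∣ N → ¬ 3 ^ 3 ∣ N →
    ∀ H₁ H₂ : AddSubgroup (W.geomTorsion 3), Nat.card H₁ = 3 → Nat.card H₂ = 3 →
      (∀ σ : absoluteGaloisGroup ℚ, ∀ a ∈ H₁, σ • a ∈ H₁) → (∀ σ : absoluteGaloisGroup ℚ, ∀ a ∈ H₂, σ • a ∈ H₂) → H₁ = H₂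

/-- **E-an-225 (THE `μ`-TYPE NODE, printed-derivable).**  For a lattice-optimal `W`: `3 ∣ [Λ₀(f) : Λ₁(f)]` ⟹ `μ₃ ⊂ W`
(`HasShortMuThree W c`).  Paper: `ℂ/Λ₁(f) → ℂ/Λ₀(f)` is the isogeny `E₁ → E₀` dual to `π^*| : E₀ → E₁`, whose kernel is
`E₀ ∩ Σ(N)`; `Σ(N) = ker(J₀(N) → J₁(N))` is of multiplicative type, so `3 ∣ [Λ₀:Λ₁] = #(E₀ ∩ Σ(N))` gives `μ₃ ⊂ E₀ = W`, and
the tree's dictionary (`hasShortMuThree_of_trivialQuotientLine`) turns the `μ₃`-line into `HasShortMuThree W c`.  Strictly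
stronger than es's E-es-67♮ `PlusIndexPrimeToThreeOfNoMuThree` (PROVED below).
[cite: LingOesterle1991, §1, Cor. 1] [cite: Vatsal2005, Rem. 1.8] [cite: Stevens1989, §2]
[conjecture — printed-derivable obligation node, NOT a tree fact] -/
@[conjecture]
def ShimuraThreeKernelHasMuThree : Prop :=
  ∀ (W : WeierstrassCurve ℚ) [W.IsElliptic] [W.IsGloballyMinimal] {N : ℕ} [NeZero N]
    (D : ModularParametrizationData W N),
    (∀ z ∈ D.L.lattice, ∃ w ∈ periodLattice D.f, z = D.c * w) → ¬ ShimuraIndexPrimeTo 3 D.f → HasShortMuThree W D.c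

/-- **E-an-226 (LOCAL SIGN LEMMA at multiplicative 3, paper-provable).**  `3 ∥ N` and `μ₃ ⊂ W` (`HasShortMuThree W c`) ⟹
`λ₃(f) = −1`.  Paper: `E[3]|_{G_{ℚ₃}} ⊇ μ₃` forces the Tate-curve quadratic character to be trivial (`det = χ₃`), i.e. SPLIT
multiplicative reduction at `3`, `a₃ = +1`, `λ₃ = −a₃ = −1` (Atkin–Lehner 1970, Thm. 3).  BC5 (an g40 `sign226-out.txt`
1b8570e32b7e5b1b): all 30 835 curves with `3 ∥ N < 5·10⁵` and a `ℤ/3`- or `μ₃`-line (galrep `3B.1.1`, `3B.1.2`, `3Cs.1.1`)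
have `b₂ ≡ 1 (mod 3)` (split); 0 exceptions.  No optimality hypothesis. [cite: AtkinLehner1970, Thm. 3]
[conjecture — printed-derivable obligation node (local), NOT a tree fact] -/
@[conjecture]
def MuThreeSignAtThree : Prop :=
  ∀ (W : WeierstrassCurve ℚ) [W.IsElliptic] [W.IsGloballyMinimal] {N : ℕ} [NeZero N]
    (D : ModularParametrizationData W N),
    3 ∣ N → ¬ 3 ^ 2 ∣ N → HasShortMuThree W D.c → atkinLehnerEigenvalueAt D.f 3 = -1

/-- **E-an-226♮ (LOCAL SIGN LEMMA, rational `3`-torsion, paper-provable).**  `3 ∥ N` and a rational point of order `3` on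
`E_{W,c}` ⟹ `λ₃(f) = −1` (a non-split Tate curve over `ℚ₃` has no `ℚ₃`-rational `3`-torsion: `#E(ℚ₃)/E⁰ ≤ 2`, `#Ẽ_ns(𝔽₃) = 4`,
`Ê(3ℤ₃)` torsion-free; so the reduction is split, `a₃ = +1`).  BC5: same table (12 885 + 2 303 + 459 curves, 0 exceptions).
[cite: AtkinLehner1970, Thm. 3] [conjecture — printed-derivable obligation node (local), NOT a tree fact] -/
@[conjecture]
def ThreeTorsionSignAtThree : Prop :=
  ∀ (W : WeierstrassCurve ℚ) [W.IsElliptic] [W.IsGloballyMinimal] {N : ℕ} [NeZero N]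
    (D : ModularParametrizationData W N),
    3 ∣ N → ¬ 3 ^ 2 ∣ N → (∃ X₀ Y₀ : ℚ, IsShortThreeTorsion W D.c X₀ Y₀) → atkinLehnerEigenvalueAt D.f 3 = -1

/-- **`3 ∤ [Λ₀(f):Λ₁(f)]` at multiplicative `3` (restriction node; PROVED in the sibling `HesseOptimalityAtThreeSplit.lean` from E-an-226 ∧ E-an-226♮ via es's THEOREM AL).**
For every modular parametrization datum of level `N` with `3 ∥ N`: Shimura index prime to `3`.  No optimality.
[conjecture — obligation node closed modulo the two local sign lemmas, NOT a tree fact] -/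
@[conjecture]
def ShimuraIndexPrimeToThreeAtMultiplicativeThree : Prop :=
  ∀ (W : WeierstrassCurve ℚ) [W.IsElliptic] [W.IsGloballyMinimal] {N : ℕ} [NeZero N]
    (D : ModularParametrizationData W N), 3 ∣ N → ¬ 3 ^ 2 ∣ N → ShimuraIndexPrimeTo 3 D.f

/-- **E-an-128 / E-an-221 restricted to `9 ∥ N` (restriction node; PROVED in the sibling `HesseOptimalityAtThreeSplit.lean` from es's sign law E-es-72 ALONE).**
Lattice-optimal `W`, `9 ∥ N`, Shimura `3`-kernel ⟹ a rational point of order `3` on `E_{W,c}`. -/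
@[conjecture]
def ShimuraThreeForcesRationalThreeTorsionAtTameNine : Prop :=
  ∀ (W : WeierstrassCurve ℚ) [W.IsElliptic] [W.IsGloballyMinimal] {N : ℕ} [NeZero N]
    (D : ModularParametrizationData W N),
    (∀ z ∈ D.L.lattice, ∃ w ∈ periodLattice D.f, z = D.c * w) → 3 ^ 2 ∣ N → ¬ 3 ^ 3 ∣ N →
    ¬ ShimuraIndexPrimeTo 3 D.f → ∃ X₀ Y₀ : ℚ, IsShortThreeTorsion W D.c X₀ Y₀

/-- **E-an-222ₒ (LEVEL LAW, optimal form, all `3 ∣ N`).**  A lattice-optimal globally minimal `W` with `3 ∣ N` and a Shimura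
`3`-kernel (`3 ∣ [Λ₀(f):Λ₁(f)]`) has `27 ∣ N`.  The `9 ∣ N` case is an g40's E-an-222 `ShimuraThreeKernelForcesTwentySeven`
(file L) restricted to optimal data; the `3 ∥ N` case is new.  BC5: REF1 §R189 table C (11 / 11 certified indices `1` at
`9 ∥ N`), E-an-223's census via `shimuraThreeKernelForcesTwentySevenOpt_of_hesse`; known kernels 27a1, 54a1 (`27 ∥ N`).
= the level shadow of the Stein–Watkins `3`-isogeny conjecture. [cite: ByeonYhee2013, Conjecture (Stein–Watkins) and Thm. 1.1]
[conjecture — cell candidate, NOT a tree fact] -/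
@[conjecture]
def ShimuraThreeKernelForcesTwentySevenOpt : Prop :=
  ∀ (W : WeierstrassCurve ℚ) [W.IsElliptic] [W.IsGloballyMinimal] {N : ℕ} [NeZero N]
    (D : ModularParametrizationData W N),
    (∀ z ∈ D.L.lattice, ∃ w ∈ periodLattice D.f, z = D.c * w) → 3 ∣ N → ¬ ShimuraIndexPrimeTo 3 D.f → 3 ^ 3 ∣ N

/-! ### §2. PROVED edges -/

-- TYPER (cone split): `shimuraIndexPrimeToThreeAtMultiplicativeThree_of_signLemmas` and
-- `shimuraThreeForcesRationalThreeTorsionAtTameNine_of_signLaw` need `Theorems.ManinLocalTwoThreeShimuraIndexMuThree` (inside the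
-- `Theses.ManinLocalTwoThree` import cone) and live VERBATIM in the sibling `HesseOptimalityAtThreeSplit.lean`.

/-- The restriction node from an's all-level law E-an-128 (PROVED, trivial). -/
theorem shimuraThreeForcesRationalThreeTorsionAtTameNine_of_cuspLifting (h128 : ShimuraThreeForcesRationalThreeTorsion) :
    ShimuraThreeForcesRationalThreeTorsionAtTameNine :=
  fun W _ _ _N _ D hopt _ _ hS ↦ h128 W D hopt hS

/-- **E-an-222ₒ ⟸ E-an-223 ∧ E-an-225 ∧ E-an-226 ∧ E-es-72 (PROVED).**  `¬ SIP₃` ⟹ `μ₃ ⊂ W` (E-an-225).  At `3 ∥ N`: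
E-an-226 gives `λ₃ = −1`, THEOREM AL₍₃₎ gives `SIP₃` ⊥.  At `9 ∥ N`: a rational `3`-torsion point would make `W` an optimal
Hesse curve, excluded by E-an-223; without one, E-es-72 gives `λ₃ = −1` and AL₍₃₎ ⊥.  Hence `27 ∣ N`. -/
theorem shimuraThreeKernelForcesTwentySevenOpt_of_laws (h223 : HesseNotOptimalAtTameThree)
    (hμ : ShimuraThreeKernelHasMuThree) (h226 : MuThreeSignAtThree) (h72 : MuThreeOptimalSignAtNine) :
    ShimuraThreeKernelForcesTwentySevenOpt := by
  intro W _ _ N _ D hopt h3 hS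
  by_contra h27
  have hmu : HasShortMuThree W D.c := hμ W D hopt hS
  apply hS
  refine shimuraIndexPrimeTo_of_atkinLehnerEigenvalueAt_eq_neg_one D.f Nat.prime_three (by decide) h3 h27 ?_
  by_cases h9 : 3 ^ 2 ∣ N
  · exact h72 W D hopt h9 h27 hmu (h223 W D hopt h3 h27 hmu)
  · exact h226 W D h3 h9 hmu

/-- **E-an-222ₒ ⟸ E-an-223 ∧ E-an-128 ∧ E-an-225 (PROVED).**  A Shimura `3`-kernel gives a rational `3`-torsion point
(E-an-128, itself ⟸ F★₀ ∧ E-es-80 by an g40) and `μ₃ ⊂ W` (E-an-225): `W` is an optimal Hesse curve, which E-an-223 forbids at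
`3 ∣ N`, `27 ∤ N`. -/
theorem shimuraThreeKernelForcesTwentySevenOpt_of_hesse (h223 : HesseNotOptimalAtTameThree)
    (h128 : ShimuraThreeForcesRationalThreeTorsion) (hμ : ShimuraThreeKernelHasMuThree) :
    ShimuraThreeKernelForcesTwentySevenOpt := by
  intro W _ _ N _ D hopt h3 hS
  by_contra h27
  obtain ⟨X₀, Y₀, hT⟩ := h128 W D hopt hS
  exact h223 W D hopt h3 h27 (hμ W D hopt hS) X₀ Y₀ hT

/-- **E-es-67♮ ⟸ E-an-225 (PROVED):** the `μ`-type node in Shimura form implies es's plus-index form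
`PlusIndexPrimeToThreeOfNoMuThree` (`plusIndexPrimeTo_of_shimuraIndexPrimeTo`). -/
theorem plusIndexPrimeToThreeOfNoMuThree_of_muType (hμ : ShimuraThreeKernelHasMuThree) :
    PlusIndexPrimeToThreeOfNoMuThree := by
  intro W _ _ N _ D hopt hnmu
  refine plusIndexPrimeTo_of_shimuraIndexPrimeTo Nat.prime_three D.f ?_
  by_contra hS
  exact hnmu (hμ W D hopt hS)

end Summit.BirchSwinnertonDyer.Rank1Residual.ManinAdditive.HesseOptimality

end
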